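import Summits.QuantumFields.BalabanUV.Beta.BorderJetWard

/-!
# `BalabanUV.Beta.BorderJetWardFluct` — binder row D1, «GAUGE-LETTERS» (G3′): **THE GAUGE WARD IDENTITY OF THE ROOTED BORDER JET `T2At` IN ITS
# FLUCTUATION SLOT** (gauge element `1 + σ·a(x)` in the FLUCTUATION nilpotent `σ` of node 12's chart `U_f = (1 + σ ω̂_f)·E_f`) — the third twin of
# G3 `BorderJetWard` (gauge element in a BACKGROUND slot `τ_i`) (β sub-cell; D1 formalisation swarm LEAF PROVER 02, road «FP» ROUTE T, (COV-m) order 2)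

HONEST FRAMING (cell charter, verbatim): «discharging BetaPertH makes Balaban's UV stability UNCONDITIONAL — a real
constructive-QFT result; it is NOT the continuum limit and NOT the Clay problem.»
HONEST DEPENDENCY: continuum YM on T⁴ ⇐ BetaPertH ∧ nine spine estimates (0/9 proved); BetaPertH ⇐ (D1) ∧ (D4) ∧ CAP+tail;
G-an2-4 gates asym, D1 and NE2/3/4.
DERIVED cell leaf ([folklore] nested dual numbers + the rooted averaging calculus), BY NAME over node 12 `AveragingThirdJet` (the gauge mode in the chart `wU`,
`wU_apply`, `uG ∕ ubG`, `Qjet_wU`, `ward` — the UNROOTED identity for gauge parameters VANISHING at the two coarse endpoints; this file is its ROOTED twin with the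
ROOT TERMS kept), G1 `RootedGaugeCovariance.PhiGAt_gauge` (B7 (11) as object locator), an3's `RootedJetReflection` (`GfL`, `GbL`, `PhiLAt`, `QjetLAt`, `kσ_PhiLAt`),
`RootedJetLinear` (`QjetLAt_add ∕ _neg`, `QjetLAt_τ₁∕τ₂∕τ12_mul`), 33J `RootedT2JetDictionary` (`c00 ∕ c10 ∕ c01_QjetAt_upF`), leaf-05's `TruncatedNil4Calculus`
(`mul_invT_eq_one`, `nil4_augR`, `aug_PhiGAt_eq_one`).  No statement of Bałaban's papers, no `[cite:]`, no `def … : Prop` fact; the `def`s are [our object]s (the slot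
gauge element with a `Tau`-valued parameter and the shifted fluctuation letter for a GENERAL background letter `E`).  Discharges NO letter by itself: the FLUCTUATION-slot site law of node 12b's border table `vh2Tab`
(`Σ_κ (s((κ, z − e_κ); g, h) − s((κ, z); g, h)) = …`) is the `(0,3)`-entry of §4 at matrix-unit letters, a sequel (G4-B′); its (0.4)-symmetrised twin and the torus
face are what the (STEP) door's order-2 averaging row `c2` displays (U21 `FP/NestedStepLawTorusTransportedRowsGradedLevelZeroSymULowClosedLamW2Q2` :313, JA-TABLE
v1.5 Δ4 «the border family's fluctuation-LEG law at order 2 — not typed»; journal Q-d1leaf02-g23-1, the row OWNER an2 g43 W-an2-g43-10 «it is the fluctuation-LEG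
law of an1's symmetrised second-order border table»).  0∕4 binders.  NOT D1, NOT `BetaPertH`, NOT continuum, NOT Clay.  «not in print; our bookkeeping».

WHY A THIRD TWIN.  G3 puts the gauge element `1 + τ_i λD` in a BACKGROUND slot: the background letter of that slot picks up the pure-gauge shift `−dA`, the other
letters are rotated with a `τ_i` tag, and the reference averaging `Φ^L_ρ(0; E, Ē)` CO-TRANSFORMS, so the far gauge factor at `r + L e_μ` cancels inside `Φ · invT Φ₀`
(G3 §2) — whence the two BACKGROUND-slot site laws `BorderWardSiteLaw.vh2Tab_siteWard₁∕₂`.  The FLUCTUATION slot `f` of `s(f; g, h)` needs the gauge element in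
the fluctuation nilpotent `σ` (node 12's `uG λ = 1 + σ·ιλ`, here `uS a = 1 + σ·a` with `a` `Tau`-valued and a general background letter): then (i) the background
letters `E_f` do not move, the reference `Φ^L_ρ(0; E, Ē)` does NOT co-transform and the far factor SURVIVES, conjugated by the background averaging `Φ₀ =
Φ^L_ρ(0; E, Ē).fst` (§2: `QjetLAt ρ ω′ = QjetLAt ρ ω + a(r) − Φ₀·a(r + L e_μ)·invT Φ₀` — the `σ`-part of `logT` is ADDITIVE, so the identity is EXACT and, at `ω = 0`,
fluctuation-free; node 12's `Qjet_wU` is the case `ρ = 0`, `λ(c₋) = λ(c₊) = 0`, where both root factors are `1`); (ii) the fluctuation letter picks up the pure-gauge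
shift `a(f₋) − a(f₊)` AND the far-end rotation defect `a(f₊) − Ad_{E_f} a(f₊)` of the background letter (`shiftω`) — at `a = ι∘λ`, `E = Ebg B B′` this IS node 12's
gauge mode `wU λ B B′` (§3), whose components are `−(∇λ, [B,λ₊], [B′,λ₊], [B,[B′,λ₊]])` (`wU_apply`), so by `Tau`-linearity of the jet the `τ₁τ₂`-component expresses
`c11 Q^ρ(upF ∇λ; B, B′)` through FIRST-order border functionals of the gauge modes, ONE linear averaging, and the ROOT term (§4).

WHAT (`r = L·y + ρ`, `ℓ = L^d`; `∇λ = grad λ`, `[B,λ₊] = gmode1 B λ`, `[B,[B′,λ₊]] = gmode2o B B′ λ` — node 12's letters, `λ : sites → 𝔸`):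
* §1 [our object] `uS a x = 1 + σ·a(x)`, `ubS a x = 1 − σ·a(x)` (inverse pair; node 12's `uG ∕ ubG` at `a = ι∘λ`), the shifted letter `shiftω a E Ē ω = ω + a(·₋) −
  E·a(·₊)·Ē`; CHART LEMMAS (`Ē E = 1`; node 12's `gaugeF_Gf_zero ∕ gaugeB_Gb_zero` at `ω = 0`, `E = Ebg`):
  `gaugeF (uS a) (ubS a) (GfL ω E) = GfL (shiftω a E Ē ω) E`, `gaugeB … (GbL ω Ē) = GbL (shiftω a E Ē ω) Ē`.
* §2 `PhiLAt_gauge` (G1): `Φ^L_ρ(ω′; E, Ē) = u(r)·Φ^L_ρ(ω; E, Ē)·ū(r + L e_μ)`; `PhiLAt_mul_invT_eq`: `Φ(ω)·invT Φ(0) = 1 + σ·QjetLAt ρ ω E Ē` (augmentation-one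
  backgrounds); **MASTER `QjetLAt_gauge`** and the fluctuation-free **WARD IDENTITY `QjetLAt_shift`**: `QjetLAt ρ (shiftω a E Ē 0) E Ē = a(r) − Φ₀·a(r + L e_μ)·invT Φ₀`.
* §3 `shiftω_ι_eq_wU`: at `a = ι∘λ`, `E = Ebg B B′`, `Ē = Ebi B B′`: `shiftω a E Ē 0 = wU λ B B′` (node 12's gauge mode, BY NAME).
* §4 **`c11_QjetAt_grad`** (`(L:𝕜) ≠ 0`, char ≠ 2; ANY `λ`): `c11 Q^ρ(upF ∇λ; B, B′) = c11(Φ₀·ι(λ(r + L e_μ))·invT Φ₀) − (2ℓ²)⁻¹•vhUAt ρ [B,λ₊] B′ − (2ℓ²)⁻¹•vhUAt ρ [B′,λ₊] B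
  − ℓ⁻¹•linAvgAt ρ [B,[B′,λ₊]]`, `Φ₀ = (PhiRAt ρ 0 B B′).fst` — node 12's `ward` ROOTED and WITH THE ROOT TERM; **`T2At_gauge_fluct`** = the sum over the two orders of
  the pair — the jet form of the FLUCTUATION-slot site law of the border table (each background's far-end gauge mode paired by the first-order border functional
  with the OTHER background; the ordered double gauge mode read by the linear averaging — the diagonal `g = h` contact; the root term at the far end of the coarse
  bond); `c11_root_eq_zero_of_lam_eq_zero` (consistency with node 12's endpoint-vanishing case).
NOT HERE: the `(0,3)`-entries at matrix units (G4-B′, the site law of `vh2Tab` in its first slot at EVERY site incl. the root's far end), the (0.4)-symmetrised twin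
over `symPhiGAt` (as `SymBorderJetWard` twins G3), the torus face (`c2`); the components of the root term `c11(Φ₀·ι(λ(r₊))·invT Φ₀)` in `linAvgAt ∕ hessUAt` letters
(33J `RootedT2JetDictionary` §3; the sequel evaluates them at matrix units).
Provenance: D1 formalisation swarm LEAF PROVER 02, unit b2b-balaban-beta-d1-formalise-leaf-02 gen 23, 2026-08-22; no existing file touched.
-/

namespace Summit.QuantumFields.BalabanUV.Beta.BorderJetWardFluct

open Finset
open Literature.MathematicalPhysics.QuantumFieldTheory.Balaban1983to89
open Literature.MathematicalPhysics.QuantumFieldTheory.Balaban1983to89.Beta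
open AffineAveraging (Form1 unitVec)
open AveragingContoursRooted (linAvgAt)
open AveragingHessianKernelsRooted (vhUAt)
open AveragingContours (grad)
open AveragingGaugeModes (gmode1)
open AveragingThirdJet (Tau Rho dmk fst_dmk snd_dmk dfst_mul dsnd_mul dmk_eq upF upF_apply Ebg Ebi logT invT augR augR_apply gaugeF gaugeB
  logT_dmk_one c00_Ebg c00_Ebi Ebi_mul_Ebg Ebg_mul_Ebi wU wU_apply gmode2o)
open AveragingThirdJet.Tau (τ₁ τ₂ τ12 ι c00 c10 c01 c11 mk ext4 τ₁_comm τ₂_comm τ12_comm)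
open AveragingMixedJetTables (PhiGAt QjetAt T2At PhiRAt)
open Summit.QuantumFields.BalabanUV.Beta.TruncatedNil4Calculus (nil4_augR mul_invT_eq_one invT_mul_eq_one aug_PhiGAt_eq_one)
open Summit.QuantumFields.BalabanUV.Beta.RootedGaugeCovariance (PhiGAt_gauge)
open Summit.QuantumFields.BalabanUV.Beta.RootedJetReflection (GfL GbL PhiLAt QjetLAt fst_GfL snd_GfL fst_GbL snd_GbL augR_GfL augR_GbL
  QjetAt_eq_QjetLAt PhiRAt_eq_PhiLAt kσ_PhiLAt snd_PhiLAt_zero snd_invT_PhiLAt_zero)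
open Summit.QuantumFields.BalabanUV.Beta.RootedJetLinear (QjetLAt_add QjetLAt_sub QjetLAt_neg QjetLAt_τ₁_mul QjetLAt_τ₂_mul QjetLAt_τ12_mul)
open Summit.QuantumFields.BalabanUV.Beta.RootedT2JetDictionary (c00_QjetAt_upF c10_QjetAt_upF c01_QjetAt_upF)

variable {𝕜 : Type*} [Field 𝕜] {d : ℕ} {𝔸 : Type*} [Ring 𝔸] [Algebra 𝕜 𝔸]

/-! ## §1 The gauge element in the fluctuation slot, and the chart lemmas -/

section Slot

variable (a : (Fin d → ℤ) → Tau 𝔸)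

/-- [our object] The gauge element in the FLUCTUATION slot: `u(x) = 1 + σ·a(x)` (`a(x) ∈ Tau 𝔸` arbitrary; `σ` = the outer nilpotent of `Rho 𝔸`). -/
def uS (x : Fin d → ℤ) : Rho 𝔸 := dmk 1 (a x)

/-- [our object] Its inverse `ū(x) = 1 − σ·a(x)`. -/
def ubS (x : Fin d → ℤ) : Rho 𝔸 := dmk 1 (-a x)

omit [Algebra 𝕜 𝔸] in
/-- [folklore] `u ū = 1`. -/
theorem uS_mul_ubS (x : Fin d → ℤ) : uS a x * ubS a x = 1 :=
  TrivSqZeroExt.ext (by simp [uS, ubS]) (by simp [uS, ubS])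

omit [Algebra 𝕜 𝔸] in
/-- [folklore] `ū u = 1`. -/
theorem ubS_mul_uS (x : Fin d → ℤ) : ubS a x * uS a x = 1 :=
  TrivSqZeroExt.ext (by simp [uS, ubS]) (by simp [uS, ubS])

/-- [our object] **THE SHIFTED FLUCTUATION LETTER** under the fluctuation-slot gauge: `ω′_f = ω_f + a(f₋) − E_f · a(f₊) · Ē_f` — the fluctuation
letter picks up the pure-gauge shift `a(f₋) − a(f₊)` AND the far-end rotation defect `a(f₊) − Ad_{E_f} a(f₊)` of the background letter. -/
def shiftω (E Eb ω : Form1 d (Tau 𝔸)) : Form1 d (Tau 𝔸) := fun κ x => ω κ x + a x - E κ x * a (x + unitVec κ) * Eb κ x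

omit [Algebra 𝕜 𝔸] in
/-- [folklore] **FORWARD CHART LEMMA** (`Ē_f E_f = 1`): `u(x)·(1 + σω)E·ū(x + e_κ) = (1 + σω′)·E`. -/
theorem gaugeF_GfL (E Eb ω : Form1 d (Tau 𝔸)) (hEE : ∀ κ x, Eb κ x * E κ x = 1) :
    gaugeF (uS a) (ubS a) (GfL ω E) = GfL (shiftω a E Eb ω) E := by
  funext κ x
  refine TrivSqZeroExt.ext ?_ ?_
  · simp [gaugeF, uS, ubS, GfL]
  · simp only [gaugeF, uS, ubS, GfL, shiftω, dsnd_mul, dfst_mul, fst_dmk, snd_dmk, one_mul, mul_one, mul_neg, add_mul, sub_mul]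
    rw [mul_assoc (E κ x * a (x + unitVec κ)) (Eb κ x) (E κ x), hEE, mul_one]
    abel

omit [Algebra 𝕜 𝔸] in
/-- [folklore] **BACKWARD CHART LEMMA** (`Ē_f E_f = 1`): `u(x + e_κ)·Ē(1 − σω)·ū(x) = Ē·(1 − σω′)`. -/
theorem gaugeB_GbL (E Eb ω : Form1 d (Tau 𝔸)) (hEE : ∀ κ x, Eb κ x * E κ x = 1) :
    gaugeB (uS a) (ubS a) (GbL ω Eb) = GbL (shiftω a E Eb ω) Eb := by
  funext κ x
  refine TrivSqZeroExt.ext ?_ ?_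
  · simp [gaugeB, uS, ubS, GbL]
  · simp only [gaugeB, uS, ubS, GbL, shiftω, dsnd_mul, dfst_mul, fst_dmk, snd_dmk, one_mul, mul_one, mul_neg, mul_add, mul_sub, neg_sub]
    rw [← mul_assoc (Eb κ x) (E κ x * a (x + unitVec κ)) (Eb κ x), ← mul_assoc (Eb κ x) (E κ x), hEE, one_mul]
    abel

/-! ## §2 MASTER: the rooted jet of the shifted fluctuation letter -/

/-- [folklore] **THE CHART AVERAGING UNDER THE FLUCTUATION-SLOT GAUGE** (G1 `PhiGAt_gauge`): `Φ^L_ρ(ω′; E, Ē) = u(r)·Φ^L_ρ(ω; E, Ē)·ū(r + L e_μ)` —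
the background letters do NOT move, so the reference `Φ^L_ρ(0; E, Ē)` does not co-transform (unlike G3's background-slot gauge). -/
theorem PhiLAt_gauge (E Eb ω : Form1 d (Tau 𝔸)) (hEE : ∀ κ x, Eb κ x * E κ x = 1) (ρ : Fin d → ℤ) (L : ℕ) (μ : Fin d) (y : Fin d → ℤ) :
    PhiLAt 𝕜 ρ (shiftω a E Eb ω) E Eb L μ y
      = uS a ((L : ℤ) • y + ρ) * PhiLAt 𝕜 ρ ω E Eb L μ y * ubS a ((L : ℤ) • y + ρ + (L : ℤ) • unitVec μ) := by
  rw [PhiLAt, PhiLAt, ← gaugeF_GfL a E Eb ω hEE, ← gaugeB_GbL a E Eb ω hEE]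
  exact PhiGAt_gauge (uS_mul_ubS a) (ubS_mul_uS a) ρ L μ y

variable {E Eb : Form1 d (Tau 𝔸)} (hE : ∀ κ x, c00 (E κ x) = 1) (hEb : ∀ κ x, c00 (Eb κ x) = 1)
include hE hEb

/-- [folklore] The fluctuation-free averaging has augmentation one. -/
theorem augR_PhiLAt_zero (ρ : Fin d → ℤ) (L : ℕ) (μ : Fin d) (y : Fin d → ℤ) : augR 𝕜 (PhiLAt 𝕜 ρ 0 E Eb L μ y) = 1 :=
  aug_PhiGAt_eq_one (fun κ x => by rw [augR_GfL, hE]) (fun κ x => by rw [augR_GbL, hEb]) ρ L μ y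

omit hE hEb in
/-- [folklore] `Φ(ω).fst = Φ(0).fst` — the background part of the averaging does not see the fluctuation letter. -/
theorem fst_PhiLAt (ρ : Fin d → ℤ) (ω : Form1 d (Tau 𝔸)) (L : ℕ) (μ : Fin d) (y : Fin d → ℤ) :
    (PhiLAt 𝕜 ρ ω E Eb L μ y).fst = (PhiLAt 𝕜 ρ 0 E Eb L μ y).fst := by
  have h := congrArg TrivSqZeroExt.fst (kσ_PhiLAt (𝕜 := 𝕜) ρ ω E Eb L μ y)
  rw [AveragingMixedJetTables.kσ_apply, fst_dmk] at h
  exact h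

/-- [folklore] `Φ(0).fst · (invT Φ(0)).fst = 1`. -/
theorem fst_PhiLAt_zero_mul_fst_invT (ρ : Fin d → ℤ) (L : ℕ) (μ : Fin d) (y : Fin d → ℤ) :
    (PhiLAt 𝕜 ρ 0 E Eb L μ y).fst * (invT (PhiLAt 𝕜 ρ 0 E Eb L μ y)).fst = 1 := by
  have h := congrArg TrivSqZeroExt.fst (mul_invT_eq_one (R := Rho 𝔸) (ag := augR 𝕜) nil4_augR (augR_PhiLAt_zero hE hEb ρ L μ y))
  rw [dfst_mul] at h
  exact h

/-- [folklore] `(invT Φ(0)).fst · Φ(0).fst = 1`. -/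
theorem fst_invT_mul_fst_PhiLAt_zero (ρ : Fin d → ℤ) (L : ℕ) (μ : Fin d) (y : Fin d → ℤ) :
    (invT (PhiLAt 𝕜 ρ 0 E Eb L μ y)).fst * (PhiLAt 𝕜 ρ 0 E Eb L μ y).fst = 1 := by
  have h := congrArg TrivSqZeroExt.fst (invT_mul_eq_one (R := Rho 𝔸) (ag := augR 𝕜) nil4_augR (augR_PhiLAt_zero hE hEb ρ L μ y))
  rw [dfst_mul] at h
  exact h

/-- [folklore] **THE NORMALISED AVERAGING IS `1 + σ·Q`**: `Φ(ω) · invT Φ(0) = 1 + σ · QjetLAt ρ ω E Ē`. -/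
theorem PhiLAt_mul_invT_eq (ρ : Fin d → ℤ) (ω : Form1 d (Tau 𝔸)) (L : ℕ) (μ : Fin d) (y : Fin d → ℤ) :
    PhiLAt 𝕜 ρ ω E Eb L μ y * invT (PhiLAt 𝕜 ρ 0 E Eb L μ y) = dmk 1 (QjetLAt 𝕜 ρ ω E Eb L μ y) := by
  have h1 : (PhiLAt 𝕜 ρ ω E Eb L μ y * invT (PhiLAt 𝕜 ρ 0 E Eb L μ y)).fst = 1 := by
    rw [dfst_mul, fst_PhiLAt (𝕜 := 𝕜) (E := E) (Eb := Eb), fst_PhiLAt_zero_mul_fst_invT hE hEb]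
  have hX : PhiLAt 𝕜 ρ ω E Eb L μ y * invT (PhiLAt 𝕜 ρ 0 E Eb L μ y)
      = dmk 1 (PhiLAt 𝕜 ρ ω E Eb L μ y * invT (PhiLAt 𝕜 ρ 0 E Eb L μ y)).snd := by
    rw [← h1]; exact (dmk_eq _).symm
  rw [hX, QjetLAt, hX, logT_dmk_one, snd_dmk, snd_dmk]

/-- [folklore] **MASTER IDENTITY, FLUCTUATION SLOT**: `QjetLAt ρ ω′ E Ē = QjetLAt ρ ω E Ē + a(r) − Φ₀·a(r + L e_μ)·invT Φ₀` (`Φ₀ = Φ(0).fst`, `r = L·y + ρ`;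
`Ē E = 1`, augmentation-one backgrounds) — EXACT: conjugation by `u(r)` at the root is a SHIFT in the `σ`-slot, and the far factor `ū(r + L e_μ)` does NOT
cancel (the reference is not transformed) but is conjugated by the background averaging `Φ₀`. -/
theorem QjetLAt_gauge (hEE : ∀ κ x, Eb κ x * E κ x = 1) (ρ : Fin d → ℤ) (ω : Form1 d (Tau 𝔸)) (L : ℕ) (μ : Fin d) (y : Fin d → ℤ) :
    QjetLAt 𝕜 ρ (shiftω a E Eb ω) E Eb L μ y
      = QjetLAt 𝕜 ρ ω E Eb L μ y
        + (a ((L : ℤ) • y + ρ)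
          - (PhiLAt 𝕜 ρ 0 E Eb L μ y).fst * a ((L : ℤ) • y + ρ + (L : ℤ) • unitVec μ) * (invT (PhiLAt 𝕜 ρ 0 E Eb L μ y)).fst) := by
  have hP := PhiLAt_mul_invT_eq (𝕜 := 𝕜) hE hEb ρ (shiftω a E Eb ω) L μ y
  rw [PhiLAt_gauge a E Eb ω hEE] at hP
  -- compute the left-hand side componentwise
  have hX : uS a ((L : ℤ) • y + ρ) * PhiLAt 𝕜 ρ ω E Eb L μ y * ubS a ((L : ℤ) • y + ρ + (L : ℤ) • unitVec μ) * invT (PhiLAt 𝕜 ρ 0 E Eb L μ y)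
      = dmk 1 (QjetLAt 𝕜 ρ ω E Eb L μ y + (a ((L : ℤ) • y + ρ)
          - (PhiLAt 𝕜 ρ 0 E Eb L μ y).fst * a ((L : ℤ) • y + ρ + (L : ℤ) • unitVec μ) * (invT (PhiLAt 𝕜 ρ 0 E Eb L μ y)).fst)) := by
    have hq : (PhiLAt 𝕜 ρ ω E Eb L μ y).snd * (invT (PhiLAt 𝕜 ρ 0 E Eb L μ y)).fst = QjetLAt 𝕜 ρ ω E Eb L μ y := by
      have h := congrArg TrivSqZeroExt.snd (PhiLAt_mul_invT_eq (𝕜 := 𝕜) hE hEb ρ ω L μ y)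
      rw [dsnd_mul, snd_invT_PhiLAt_zero, mul_zero, zero_add, snd_dmk] at h
      exact h
    refine TrivSqZeroExt.ext ?_ ?_
    · rw [dfst_mul, dfst_mul, dfst_mul, fst_dmk, fst_PhiLAt (𝕜 := 𝕜) (E := E) (Eb := Eb)]
      simp only [uS, ubS, fst_dmk, one_mul, mul_one]
      exact fst_PhiLAt_zero_mul_fst_invT hE hEb ρ L μ y
    · rw [dsnd_mul, dsnd_mul, dsnd_mul, dfst_mul, dfst_mul, snd_invT_PhiLAt_zero, mul_zero, zero_add, snd_dmk]
      simp only [uS, ubS, fst_dmk, snd_dmk, one_mul, mul_one]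
      rw [fst_PhiLAt (𝕜 := 𝕜) (E := E) (Eb := Eb) ρ ω, add_mul, add_mul, hq, mul_neg, neg_mul,
        mul_assoc (a ((L : ℤ) • y + ρ)) ((PhiLAt 𝕜 ρ 0 E Eb L μ y).fst), fst_PhiLAt_zero_mul_fst_invT hE hEb, mul_one]
      abel
  rw [hX] at hP
  have h := congrArg TrivSqZeroExt.snd hP
  rw [snd_dmk, snd_dmk] at h
  exact h.symm

/-- [folklore] The rooted jet of the zero fluctuation vanishes. -/
theorem QjetLAt_zero (ρ : Fin d → ℤ) (L : ℕ) (μ : Fin d) (y : Fin d → ℤ) : QjetLAt 𝕜 ρ 0 E Eb L μ y = 0 := by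
  rw [QjetLAt, mul_invT_eq_one (R := Rho 𝔸) (ag := augR 𝕜) nil4_augR (augR_PhiLAt_zero hE hEb ρ L μ y), AveragingThirdJet.logT_one]
  rfl

/-- [folklore] **THE FLUCTUATION-SLOT WARD IDENTITY** (the MASTER at `ω = 0`; fluctuation-free): the rooted jet of the pure shift letter
`a(f₋) − E_f a(f₊) Ē_f` is `a(r) − Φ₀·a(r + L e_μ)·invT Φ₀`. -/
theorem QjetLAt_shift (hEE : ∀ κ x, Eb κ x * E κ x = 1) (ρ : Fin d → ℤ) (L : ℕ) (μ : Fin d) (y : Fin d → ℤ) :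
    QjetLAt 𝕜 ρ (shiftω a E Eb 0) E Eb L μ y
      = a ((L : ℤ) • y + ρ) - (PhiLAt 𝕜 ρ 0 E Eb L μ y).fst * a ((L : ℤ) • y + ρ + (L : ℤ) • unitVec μ) * (invT (PhiLAt 𝕜 ρ 0 E Eb L μ y)).fst := by
  rw [QjetLAt_gauge a hE hEb hEE, QjetLAt_zero hE hEb, zero_add]

end Slot

/-! ## §3 Node 12's gauge mode: the shift letter of `a = ι ∘ λ` against the ordered chart IS `wU λ` -/

section Letters

variable (lam : (Fin d → ℤ) → 𝔸)

omit [Algebra 𝕜 𝔸] in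
/-- [folklore] **BRIDGE TO NODE 12**: for the gauge parameter `a = ι ∘ λ` (`λ` valued in `𝔸`) and the ordered background `E = Ebg B B′`, `Ē = Ebi B B′`, the
shift letter at zero fluctuation IS node 12's GAUGE MODE IN THE CHART `wU λ B B′ = λ(b₋) − E_b λ(b₊) E_b⁻¹` (whose components are `−(∇λ, [B,λ₊], [B′,λ₊],
[B,[B′,λ₊]])`, node 12 `wU_apply`). -/
theorem shiftω_ι_eq_wU (B B' : Form1 d 𝔸) : shiftω (fun x => ι (lam x)) (Ebg B B') (Ebi B B') 0 = wU lam B B' := by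
  funext κ x
  simp only [shiftω, wU, Pi.zero_apply, zero_add]

end Letters

/-! ## §4 The rooted border jet Ward identity in the fluctuation slot, WITH the root terms -/

section Ward

variable (lam : (Fin d → ℤ) → 𝔸) {L : ℕ} (hL : (L : 𝕜) ≠ 0) (h2 : (2 : 𝕜) ≠ 0)
include hL h2

/-- [folklore] **THE ROOTED BORDER JET WARD IDENTITY, FLUCTUATION SLOT, GENERAL GAUGE PARAMETER** (node 12's `ward` is the case `ρ = 0`, `λ(c₋) = λ(c₊) = 0`):
for ANY `λ : sites → 𝔸` and any ordered background pair `(B, B′)`,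
`c11 Q^ρ(upF ∇λ; B, B′) = c11(Φ₀·ι(λ(r + L e_μ))·invT Φ₀) − (2ℓ²)⁻¹•vhUAt ρ [B,λ₊] B′ − (2ℓ²)⁻¹•vhUAt ρ [B′,λ₊] B − ℓ⁻¹•linAvgAt ρ [B,[B′,λ₊]]`,
`Φ₀ = (PhiRAt ρ 0 B B′).fst` the pure-background averaging: the first-order border functionals of each background's far-end gauge mode against the OTHER
background, the linear averaging of the ordered double gauge mode, and the ROOT term at the far end of the coarse bond (the reference does not co-transform;
the near-end term `c11 ι(λ(r)) = 0`). -/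
theorem c11_QjetAt_grad (ρ : Fin d → ℤ) (B B' : Form1 d 𝔸) (μ : Fin d) (y : Fin d → ℤ) :
    c11 (QjetAt 𝕜 ρ (upF (grad lam)) B B' L μ y)
      = c11 ((PhiRAt 𝕜 ρ 0 B B' L μ y).fst * ι (lam ((L : ℤ) • y + ρ + (L : ℤ) • unitVec μ)) * (invT (PhiRAt 𝕜 ρ 0 B B' L μ y)).fst)
        - ((2 : 𝕜) * (L : 𝕜) ^ (2 * d))⁻¹ • vhUAt ρ (gmode1 B lam) B' L μ y
        - ((2 : 𝕜) * (L : 𝕜) ^ (2 * d))⁻¹ • vhUAt ρ (gmode1 B' lam) B L μ y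
        - ((L : 𝕜) ^ d)⁻¹ • linAvgAt ρ (gmode2o B B' lam) L μ y := by
  -- the fluctuation-slot Ward identity at node 12's chart, read in the `τ₁τ₂`-component
  have key := congrArg c11 (QjetLAt_shift (𝕜 := 𝕜) (fun x => ι (lam x)) (E := Ebg B B') (Eb := Ebi B B')
    (fun κ x => c00_Ebg _ _ κ x) (fun κ x => c00_Ebi _ _ κ x) (fun κ x => Ebi_mul_Ebg _ _ κ x) ρ L μ y)
  have hw : wU lam B B' = -(upF (grad lam) + (fun κ x => τ₁ * upF (gmode1 B lam) κ x)
      + (fun κ x => τ₂ * upF (gmode1 B' lam) κ x) + (fun κ x => τ12 * upF (gmode2o B B' lam) κ x)) := by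
    funext κ x
    simp only [Pi.neg_apply, Pi.add_apply, upF_apply]
    exact wU_apply lam B B' κ x
  rw [shiftω_ι_eq_wU, hw, QjetLAt_neg, QjetLAt_add, QjetLAt_add, QjetLAt_add, QjetLAt_τ₁_mul, QjetLAt_τ₂_mul, QjetLAt_τ12_mul,
    ← QjetAt_eq_QjetLAt, ← QjetAt_eq_QjetLAt, ← QjetAt_eq_QjetLAt, ← QjetAt_eq_QjetLAt, ← PhiRAt_eq_PhiLAt] at key
  simp only [AveragingThirdJet.Tau.c11_add, AveragingThirdJet.Tau.c11_neg, AveragingThirdJet.Tau.c11_sub, AveragingThirdJet.Tau.c11_τ₁_mul,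
    AveragingThirdJet.Tau.c11_τ₂_mul, AveragingThirdJet.Tau.c11_τ12_mul, AveragingThirdJet.Tau.c11_ι, zero_sub,
    c01_QjetAt_upF (hL := hL) (h2 := h2), c10_QjetAt_upF (hL := hL) (h2 := h2), c00_QjetAt_upF (hL := hL)] at key
  -- key : −(c11 Q(upF ∇λ) + vh + vh' + lin) = −c11 (Φ₀ · ι(λ(r₊)) · P₀); solve for `c11 Q(upF ∇λ)`
  have h0 := sub_eq_zero.mpr key
  refine eq_of_sub_eq_zero ?_
  rw [← neg_eq_zero, ← h0]
  abel

/-- [folklore] **THE GAUGE WARD IDENTITY OF THE ROOTED BORDER JET `T2At` IN ITS FLUCTUATION SLOT** (the sum of the two orders of the background pair):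
`T2At ρ (upF ∇λ) B B′ = [order (B, B′)] + [order (B′, B)]` — every term a first-order (`vhUAt`) or zeroth-order (`linAvgAt`) functional of gauge-mode letters,
plus the two ROOT terms of the two ordered background averagings. -/
theorem T2At_gauge_fluct (ρ : Fin d → ℤ) (B B' : Form1 d 𝔸) (μ : Fin d) (y : Fin d → ℤ) :
    T2At 𝕜 ρ (upF (grad lam)) B B' L μ y
      = (c11 ((PhiRAt 𝕜 ρ 0 B B' L μ y).fst * ι (lam ((L : ℤ) • y + ρ + (L : ℤ) • unitVec μ)) * (invT (PhiRAt 𝕜 ρ 0 B B' L μ y)).fst)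
          - ((2 : 𝕜) * (L : 𝕜) ^ (2 * d))⁻¹ • vhUAt ρ (gmode1 B lam) B' L μ y
          - ((2 : 𝕜) * (L : 𝕜) ^ (2 * d))⁻¹ • vhUAt ρ (gmode1 B' lam) B L μ y
          - ((L : 𝕜) ^ d)⁻¹ • linAvgAt ρ (gmode2o B B' lam) L μ y)
        + (c11 ((PhiRAt 𝕜 ρ 0 B' B L μ y).fst * ι (lam ((L : ℤ) • y + ρ + (L : ℤ) • unitVec μ)) * (invT (PhiRAt 𝕜 ρ 0 B' B L μ y)).fst)
          - ((2 : 𝕜) * (L : 𝕜) ^ (2 * d))⁻¹ • vhUAt ρ (gmode1 B' lam) B L μ y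
          - ((2 : 𝕜) * (L : 𝕜) ^ (2 * d))⁻¹ • vhUAt ρ (gmode1 B lam) B' L μ y
          - ((L : 𝕜) ^ d)⁻¹ • linAvgAt ρ (gmode2o B' B lam) L μ y) := by
  rw [T2At, c11_QjetAt_grad lam hL h2, c11_QjetAt_grad lam hL h2]

omit hL h2 in
/-- [folklore] Consistency with node 12: at `ρ = 0` and `λ(c₋) = λ(c₊) = 0` the root term vanishes (`c11 (Φ₀·ι 0·P₀) = 0`). -/
theorem c11_root_eq_zero_of_lam_eq_zero (ρ : Fin d → ℤ) (B B' : Form1 d 𝔸) (μ : Fin d) (y : Fin d → ℤ)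
    (h1 : lam ((L : ℤ) • y + ρ + (L : ℤ) • unitVec μ) = 0) :
    c11 ((PhiRAt 𝕜 ρ 0 B B' L μ y).fst * ι (lam ((L : ℤ) • y + ρ + (L : ℤ) • unitVec μ)) * (invT (PhiRAt 𝕜 ρ 0 B B' L μ y)).fst) = 0 := by
  rw [h1, AveragingThirdJet.ι_zero, mul_zero, zero_mul, AveragingThirdJet.Tau.c11_zero]

end Ward

end Summit.QuantumFields.BalabanUV.Beta.BorderJetWardFluct
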